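import Summits.NavierStokesRegularity.NavierStokesRegularity.Theorems.SoloSalvageGlimmPetrillo2026
import Literature.Barriers.NavierStokesRegularity.SmallDataGlobalRegularity
import Literature.Analysis.FluidPDE.NSGalerkinCrossIdentity
import HarnessLib

/-!
# C07 `GlimmPetrillo2026` — the amplitude audit of Theorem 5.1 for EVERY reading of the undefined notions

Cell `ns-claims` (D-0090 NS-CLAIMS SWEEP), salvage seat `ns-claims-salvage-p5` (MAP-SCHEMA v0.5 §4b
«SMALL-DATA / AMPLITUDE AUDIT»; companion of refuter-3's `Theorems/SoloRefuteGlimmPetrillo2026.lean`,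
p469838, which refutes the typed floor `Step_3` and the headline in the natural reading
`Notions.natural`). The skeleton `Literature/Claims/NS/GlimmPetrillo2026.lean` (typist-5, p466336)
carries the two notions the paper never defines — «entropy maximizing solution», «turbulent datum» — as a
parameter `N : Notions`. This file records the kernel fact that NO reading rescues Theorem 5.1 as long as

* «turbulent» is amplitude-blind below `1` (`u₀` turbulent ⇒ `c•u₀` turbulent, `0 < c < 1`; the printed
  Definition 5.1 «E mode strictly non-zero, non-SRI» is a condition on which modes are present, not on
  their size),
* some turbulent finite-mode datum exists (`Step_1 N`), and
* Theorem 3.1 (a) holds in the reading `N` (`Step_2 N`: every admissible datum launches an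
  entropy-maximising global Leray–Hopf solution):

`not_claimedTheorem_of_coneLike : Step_1 N → Step_2 N → (cone) → ¬ ClaimedTheorem N`. Proof: a small
multiple `c•u₀` of the turbulent datum is a Clay datum with a GLOBAL classical solution (small-data global
regularity on `𝕋³`, RRS 2016 Thm 6.12 — tree `Torus.exists_global_classicalNS_smul`, barrier file
`SmallDataGlobalRegularity`, p458172); the selected Leray–Hopf solution from `c•u₀` coincides with it a.e.
(weak–strong uniqueness, RRS Thm 6.10 — tree `Torus.IsGlobalLerayHopf.ae_eq_of_isClassicalNSSolutionOn_Ici`,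
p461824), hence is globally regular, contradicting the headline. `isFiniteModeDatum_smul`: the data class
of Theorem 5.1 is a cone.

WHAT THIS IS NOT: not a claim about NS regularity or blow-up; not a claim about any author beyond
the typed locator.
-/

noncomputable section

open MeasureTheory Set Filter Function
open scoped ENNReal Topology

-- The mandated landing namespace repeats the summit name by design (D-0017).
set_option linter.dupNamespace false

namespace Summit.NavierStokesRegularity.NavierStokesRegularity.Theorems

namespace GlimmPetrillo2026

open Literature.Claims.NS.GlimmPetrillo2026 Literature.Analysis Literature.Analysis.FluidPDE
  Literature.Analysis.FunctionSpaces Literature.Barriers.NavierStokesRegularity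

section AmplitudeAudit

/-- The finite-mode data class is a cone: `c • u₀` is again a divergence-free zero-mean trigonometric
polynomial. [cite: GlimmPetrillo2026, Thm 5.1 proof l.1213–1216] -/
theorem isFiniteModeDatum_smul {u₀ : UnitAddTorus (Fin 3) → EuclideanSpace ℝ (Fin 3)}
    (h : IsFiniteModeDatum u₀) (c : ℝ) : IsFiniteModeDatum (c • u₀) := by
  obtain ⟨⟨S, C, rfl⟩, hdiv, hmean⟩ := h
  have hsm : Torus.IsSmooth (Torus.realTrigPoly S C) := Torus.isSmooth_realTrigPoly S C
  refine ⟨⟨S, c • C, ?_⟩, ?_, ?_⟩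
  · funext x
    rw [Pi.smul_apply, realTrigPoly_real_smul]
  · -- divergence free
    intro x
    change ∑ i, Torus.partialDeriv i (fun y => (c • Torus.realTrigPoly S C y) i) x = 0
    have hfun : ∀ i, (fun y => (c • Torus.realTrigPoly S C y) i) = c • fun y => Torus.realTrigPoly S C y i :=
      fun i => by funext y; simp
    simp only [hfun, Torus.partialDeriv_const_smul ((hsm.apply _).isContDiff (by simp)), Pi.smul_apply,
      smul_eq_mul, ← Finset.mul_sum]
    rw [show ∑ i, Torus.partialDeriv i (fun y => Torus.realTrigPoly S C y i) x =
      Torus.divergence (Torus.realTrigPoly S C) x from rfl, hdiv x, mul_zero]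
  · unfold Torus.HasZeroMean at hmean ⊢
    simp [Pi.smul_apply, integral_smul, hmean]

/-- **AMPLITUDE AUDIT of Theorem 5.1 (MAP-SCHEMA v0.5 §4b) — for EVERY reading `N` of the undefined
notions in which «turbulent» is insensitive to shrinking the amplitude and Theorem 3.1 (a) holds.** If
`N.IsTurbulent` is a cone below `1` (`u₀` turbulent ⇒ `c•u₀` turbulent for `0 < c < 1`; the printed
Definition 5.1 «E mode non-zero, non-SRI» is amplitude-blind), some turbulent finite-mode datum exists
(`Step_1 N`), and every admissible datum launches an entropy-maximising global Leray–Hopf solution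
(`Step_2 N`), then the claimed Theorem 5.1 is FALSE: a small multiple `c•u₀` is a Clay datum with a GLOBAL
classical solution (small-data global regularity on `𝕋³`, tree `Torus.exists_global_classicalNS_smul`,
RRS 2016 Thm 6.12), with which the selected Leray–Hopf solution coincides a.e. (weak–strong uniqueness,
`Torus.IsGlobalLerayHopf.ae_eq_of_isClassicalNSSolutionOn_Ici`, p461824) — so it IS globally regular.
(salvage-p5; composes the barrier `SmallDataGlobalRegularity` p458172 with p461824.)
[cite: GlimmPetrillo2026, Thm 5.1 l.1204–1207 and Def. 5.1 l.1182–1188] [cite: RobinsonRodrigoSadowski2016, Thm. 6.12 and Thm. 6.10] -/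
theorem not_claimedTheorem_of_coneLike (N : Notions) (h1 : Step_1 N) (h2 : Step_2 N)
    (hcone : ∀ u₀, N.IsTurbulent u₀ → ∀ c : ℝ, 0 < c → c < 1 → N.IsTurbulent (c • u₀)) :
    ¬ ClaimedTheorem N := by
  intro hC
  obtain ⟨u₀, hfm, hne, hturb⟩ := h1
  have hadm : IsAdmissibleDatum u₀ := hfm.isAdmissibleDatum
  -- the claimed theorem at every viscosity; take `ν = 1`
  obtain ⟨c₀, hc₀, hsmall⟩ :=
    Torus.exists_global_classicalNS_smul (d := Fin 3) (by simp) one_pos hadm.1 hadm.2.1 hadm.2.2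
  set c : ℝ := min c₀ (1 / 2) with hc
  have hcpos : 0 < c := lt_min hc₀ (by norm_num)
  have hc1 : c < 1 := (min_le_right _ _).trans_lt (by norm_num)
  have hcle : |c| ≤ c₀ := by rw [abs_of_pos hcpos]; exact min_le_left _ _
  -- the small multiple: a turbulent non-zero finite-mode datum with a GLOBAL classical solution
  have hfm' : IsFiniteModeDatum (c • u₀) := isFiniteModeDatum_smul hfm c
  have hne' : c • u₀ ≠ 0 := smul_ne_zero hcpos.ne' hne
  have hturb' : N.IsTurbulent (c • u₀) := hcone u₀ hturb c hcpos hc1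
  obtain ⟨v, p, hv, hv0, -⟩ := hsmall c hcle
  -- the selected Leray–Hopf solution from `c • u₀`
  obtain ⟨u, hLH, hsel⟩ := h2 1 one_pos (c • u₀) hfm'.isAdmissibleDatum
  have hng : ¬ IsGloballyRegular 1 (c • u₀) u := (hC 1 one_pos (c • u₀) hfm' hne' hturb' u hLH hsel).2
  apply hng
  refine ⟨v, p, hv, hv0, ?_⟩
  have hLH' : Torus.IsGlobalLerayHopf 1 0 (v 0) u := by rw [hv0]; exact hLH
  exact hLH'.ae_eq_of_isClassicalNSSolutionOn_Ici hv zero_le_one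

end AmplitudeAudit

end GlimmPetrillo2026

end Summit.NavierStokesRegularity.NavierStokesRegularity.Theorems

end
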